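import Summits.Ventures.AbcSig.Rows.XTemplateHalves
import Summits.Ventures.AbcSig.Rows.XTemplateC2a
import Summits.Ventures.AbcSig.Rows.XTemplateAB
import Summits.Ventures.AbcSig.Rows.C2aL101A0xyeven
import Summits.Ventures.AbcSig.Levels.N202M6X

/-!
# Venture AbcSig — PARITY-HALF ROW `C2aL101A0xyevenAB`: `101^m·xⁿ + yⁿ = z²`, `xy` even (second distribution, by symmetry) at the single level 202 = 2·101 (GENERATED by p-lean g4 `gen4/evenhalf.py`)

HONEST FRAMING. A row of a COMPUTATION cell (`pub-abcsig`); a CONDITIONAL theorem, no claim on ABC or any summit.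
Hypotheses: `BS04Package` (CITED); `DataComplete 202` (COMPUTED: certified level file, ordinary ℤ[θ] certificates); `EisPackage` (CITED) + `Refines` (COMPUTED) for the module-M6 residue discharged IN THE KERNEL (`Levels/N202M6X.lean`);
the listed per-orbit exclusions `hX_…` (CITED: the row of record's closures). Only the parity half living at level 2·101 is claimed
(the complementary half needs level 32·101). Exponent range: prime `n ≥ 11`, `n ≠ 101`; `1 ≤ m < n`.
Level 202 = 2·101 (ordinary tree certificates); the module-M6 residue (202.3 @ 17) is DISCHARGED IN THE KERNEL (Levels/N202M6X.lean); other residues per the row of record's R3 (CITED hX_ if any).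
Row of record: `census/rows/C2a/C2a-l101-a0-xyeven.md` (sha16 `c1f1088f9ee02dc5`; SIGNED 2026-08-22T16:05:08Z by referee (ref-g11) — C).
-/

namespace Summit.Ventures.AbcSig

/-- Parity-half row `C2aL101A0xyevenAB`: the first distribution with `x, y` swapped (`IsPrimitiveSolution.swap`). -/
theorem xrow_C2aL101A0xyevenAB (M : NewformModel) (hP : M.BS04Package)
    (hE : M.EisPackage)
    (hR_orbit_202_3 : M.Refines 202 orbit_202_3 m6X_202_3)
    (hD202 : M.DataComplete 202 level202Orbits)
    (n : ℕ) (hn : n.Prime) (hmin : 11 ≤ n) (hnℓ : n ≠ 101) (m : ℕ) (hm : 1 ≤ m) (hmn : m < n)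
    (x y z : ℤ) (hxy : 2 ∣ x * y) : ¬ IsPrimitiveSolution (101 ^ m) (2 ^ 0) 1 n x y z := by
  intro h
  have h' : IsPrimitiveSolution 1 (2 ^ 0 * 101 ^ m) 1 n y x z := by simpa only [pow_zero, one_mul] using h.swap
  exact xrow_C2aL101A0xyeven M hP hE hR_orbit_202_3 hD202 n hn hmin hnℓ m hm hmn  y x z (by rwa [mul_comm]) h'

end Summit.Ventures.AbcSig
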